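/-
Copyright (c) 2026 the pub-hodgecm-mathlib formalisation cell (harness21).  Prover seat hodgecm-mathlib-F0P3-p01 (g32), Track A «(D-RAM) FOUR-FRAME», unit U2H, census leaf
(ρ2b′-X) — T5b «TORIC LEVEL CENSUS, type RamK»: THE EXPLICIT HYPERBOLIC TABLE (sheet (S3)).  2026-09-04.
-/
import Summits.HodgeConjecture.HodgeConjecture.Theorems.F0P3cDyRamToricCensusDefs       -- ★ p857239 (LH4-p12 (g4)): `levelSet`
import Summits.HodgeConjecture.HodgeConjecture.Theorems.F0P3cDyRamToricLevelCensusUnr    -- ★ (LH4-p08 (g4)) T5a HEAD: `levelSet_eq_setOf` BY NAME; brings ★ `QuadraticOrderLevelClasses`, `QuadraticOrderTorusIndices`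
import Literature.NumberTheory.LocalFields.QuadraticOrderNormDepthIndexRamKHalf          -- ★ p857713 (this seat, B4): `[U:B_c]·2 = …` (c ≥ 2d−1); brings ★ p857459 `[U:B_c] = idxRK` and the RamK frame
import HarnessLib

/-!
# (ρ2b′-X) T5b — the toric level census of type RamK: THE EXPLICIT HYPERBOLIC TABLE `n₊(j,a)` (sheet (S3) `ncard_levelSet_ramK_hyper`)

`Summits/HodgeConjecture/HodgeConjecture/Theorems/F0P3cDyRamToricLevelCensusRamKHyper.lean`, namespace `Summit.HodgeConjecture.HodgeConjecture.Cruxes.H413.F0P3cDyRamToricLevelCensusRamK`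
(the T5b HEAD's namespace, second file — the HEAD ★ `F0P3cDyRamToricLevelCensusRamK` holds the index forms; this file would push it past 400 lines).  PROOF FILE of a SUPPORT
organ (helper leaf `--supports stmt-HodgeConjecture-24833 --as helper`; no stub credit claimed; hodgecm-mathlib-F0P3-p01 (g32) for the (ρ2b′-X) payer LH4-p14's lineage, dealer
LH4-plan (g12) WORD #16 «T5b = TORIC LEVEL CENSUS type RamK»).  THEOREMS ONLY (no `def`, no instance, no notation, no sorry).
TYPE RamK: `K∕F` ramified, the third field `K♮ = Fix Θ` UNRAMIFIED over `F`, so `M∕E` is unramified (uniformiser `ϖE`, `ρϖE = ϖE`) and `M∕K♮` is RAMIFIED with the datum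
`(Θ, ϖE, d, t)`; `K♮` is handed over as a valued field `K'` with `jK : K' →+* M` onto `Fix Θ` (`|jK x| = |x|²`, `jK∘σ' = ρ∘jK`, `K'∕Fix σ'` unramified: `|α' − σ'α'| = 1`),
both residue fields of `q²` elements.  THIS FILE: **`ncard_levelSet_ramK_hyper`** — for an isotropic side scalar `h` (`Θh = h`) the number of order lattices `x₀·𝒪_j` with an
integral Gram-primitive dual generator of level `a` is the sheet's if-then-else table in `(q, d, j, a)` (docstring), assembled from LH4-p08 (g4)'s ★ reduction
`#L = [B_c : 𝒪_jˣ] − [B_{c+1} : 𝒪_jˣ]` (translator from isotropy), ★ `|G_j| = (q+1)q^{j−1}`, ★ `[U : B_c] = idxRK q d c` (p857459) and its division-free halved form (★ B4);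
`v(h)` is even (`h = jK s'`), so the parity gate is `j ≡ a (2)` and `c = j − a` is even.  The table equals the index-form arithmetic `|G_j|(1∕I(c) − 1∕I(c+1))` (checked by
exact rationals for `q ≤ 9`, `d ≤ 5`, `j ≤ 13` before typing).
HONEST LABEL: HC_CM is proved only modulo the 7 printed citations (2 remaining named inputs: hLiu418 = stmt-HodgeConjecture-24832, h413 = stmt-HodgeConjecture-24833) until rung 0
closes; this leaf is unconditional local algebra and count-neutral.

## References
* [Flicker1998UnitaryFL] Y. Flicker, Prop. 7 p. 84 (torus-orbit census on the tree).
* [Jacobowitz1962] R. Jacobowitz, *Hermitian forms over local fields*, Amer. J. Math. 84 (1962): §4.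
* [Serre1979] J.-P. Serre, *Local Fields*, GTM 67 (1979): Ch. V §1, §3.
-/

set_option autoImplicit false

namespace Summit.HodgeConjecture.HodgeConjecture.Cruxes.H413.F0P3cDyRamToricLevelCensusRamK

open WithZero
open scoped Pointwise Valued
open Literature.NumberTheory.LocalFields.QuadraticOrder
open Summit.HodgeConjecture.HodgeConjecture.Cruxes.H413.F0P3cDyRamToricCensusDefs

variable {K : Type} [Field K] [Valued K ℤᵐ⁰] {ρ Θ : K →+* K} {α ϖE h : K}
variable {K' : Type} [Field K'] [Valued K' ℤᵐ⁰] {σ' : K' →+* K'} {α' π' : K'}   -- the third field `K' ≅ K♮ = Fix Θ`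

/-! ## §1 THE EXPLICIT HYPERBOLIC TABLE `n₊(j,a)` of type RamK (sheet (S3) `ncard_levelSet_ramK_hyper`), two-field frame, binder-free

Frame: `M = K` complete with finite residue field of `q²` elements, `(Θ, ϖE, d, t)` a ramified quadratic datum (`M∕K♮` ramified, `K♮ = Fix Θ`), `ρϖE = ϖE` (so `M∕E` is
unramified with uniformiser `ϖE`), `K' ≅ K♮` handed over by `jK` (`|jK x| = |x|²`, `jK∘σ' = ρ∘jK`, `K'` unramified over `Fix σ'`: `|α' − σ'α'| = 1`), `Θh = h`.  Then
`v(h)` is EVEN, the parity gate is `j ≡ a (2)`, `c = j − a` is even, `[𝒪_jˣ‑cosets] = |G_j|∕I(c)` with `I = idxRK` (★ p857459, ★ B4), and the table below is the arithmetic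
of `|G_j|(1∕I(c) − 1∕I(c+1))` (checked against the index form by exact rationals for `q ≤ 9`, `d ≤ 5`, `j ≤ 13`). -/

open Literature.NumberTheory.Automorphic.UnitaryThreeFourFrame in
/-- **THE HYPERBOLIC RamK LEVEL TABLE (sheet (S3))**: for an isotropic side `h` (`Θh = h`), with `c = j − a`:
`#L_h(j,a) = 1∕0` (`j = 0`, `a = 0` ∕ `a ≥ 1`); `0` if `j < a` or `c` odd; `q^j` (`a = j`, `d ≥ 2`) ∕ `(q−1)q^{j−1}` (`a = j`, `d = 1`); `q^{j∕2}` ∕ `2q^{j∕2}` (`a = 0`, `j + 2 ≤ 2d` ∕ not);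
`(q−1)q^{j−1−c∕2}` (`c + 2 < 2d`); `(q−2)q^{j−d}` (`c + 2 = 2d`); `2(q−1)q^{j−1−c∕2}` (`c + 2 > 2d`). [cite: Flicker1998UnitaryFL, Prop. 7 p. 84] [cite: Jacobowitz1962, §4]
[cite: Serre1979, Ch. V §3] -/
theorem ncard_levelSet_ramK_hyper [CompleteSpace K] [IsDiscreteValuationRing 𝒪[K]] [Finite 𝓀[K]]
    [CompleteSpace K'] [IsDiscreteValuationRing 𝒪[K']] [Finite 𝓀[K']]
    (hρρ : ∀ x, ρ (ρ x) = x) (hvρ : ∀ x, Valued.v (ρ x) = Valued.v x) (hΘρ : ∀ x, Θ (ρ x) = ρ (Θ x))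
    (hα1 : Valued.v α ≤ 1) (hα : Valued.v (α - ρ α) = 1) {d t : ℕ} (hD : IsRamifiedQuadraticDatum Θ ϖE d t) (hρϖ : ρ ϖE = ϖE)
    (hΘh : Θ h = h) (hh : h ≠ 0) {q : ℕ} (hq : Nat.card 𝓀[K] = q ^ 2)
    (hσ' : ∀ x, σ' (σ' x) = x) (hvσ' : ∀ x, Valued.v (σ' x) = Valued.v x) (hα'1 : Valued.v α' ≤ 1) (hα' : Valued.v (α' - σ' α') = 1)
    (hπ' : Valued.v π' = exp (-1 : ℤ)) (hq' : Nat.card 𝓀[K'] = q ^ 2)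
    (jK : K' →+* K) (hjv : ∀ x, Valued.v (jK x) = Valued.v x ^ 2) (hjΘ : ∀ x, Θ (jK x) = jK x) (hjfix : ∀ z : K, Θ z = z → ∃ x, jK x = z)
    (hjσ : ∀ x, jK (σ' x) = ρ (jK x))
    (hhyper : ∃ x : K, x ≠ 0 ∧ h * Θ x * x + ρ (h * Θ x * x) = 0) (j a : ℕ) :
    (levelSet ρ Θ α ϖE h j a).ncard =
      if j = 0 then (if a = 0 then 1 else 0)
      else if j < a ∨ (j - a) % 2 = 1 then 0
      else if a = j then (if 2 ≤ d then q ^ j else (q - 1) * q ^ (j - 1))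
      else if a = 0 then (if 2 * d ≤ j + 1 then 2 else 1) * q ^ (j / 2)
      else if j - a + 2 < 2 * d then (q - 1) * q ^ (j - 1 - (j - a) / 2)
      else if j - a + 2 = 2 * d then (q - 2) * q ^ (j - d)
      else 2 * (q - 1) * q ^ (j - 1 - (j - a) / 2) := by
  classical
  have hΘΘ : ∀ x, Θ (Θ x) = x := hD.1
  have hvΘ : ∀ x, Valued.v (Θ x) = Valued.v x := hD.2.1
  have hϖE : Valued.v ϖE = exp (-1 : ℤ) := hD.2.2.1
  have hd : 1 ≤ d := hD.2.2.2.2.2.1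
  have hq2 : 2 ≤ q := by
    have h1 : 1 < Nat.card 𝓀[K] := Finite.one_lt_card
    rw [hq] at h1
    by_contra hlt
    interval_cases q <;> simp at h1
  have hq0 : 0 < q := by omega
  -- (1) translator and parity: `v(h) = exp(−2k)` (`h = jK s'`, `|jK s'| = |s'|²`)
  obtain ⟨ω₀, hω₀, hη⟩ := exists_unit_twist_eq_of_isotropic hΘρ hϖE hρϖ hh hhyper
  obtain ⟨s', hs'⟩ := hjfix h hΘh
  have hs'0 : s' ≠ 0 := by rintro rfl; rw [map_zero] at hs'; exact hh hs'.symm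
  obtain ⟨k, u', hu', hs'eq⟩ := exists_eq_varpi_zpow_mul_unit hπ' hs'0
  have hvh : Valued.v h = exp (-(2 * k)) := by
    rw [← hs', hjv, hs'eq, map_mul, hu', mul_one, (v_varpi_zpow hπ' k).2, sq, ← exp_add]
    congr 1; ring
  -- (2) the subgroups `U ⊇ B_c ⊇ H = 𝒪_jˣ` and their indices
  obtain ⟨U, hU⟩ := Literature.NumberTheory.LocalFields.WildQuadraticDatum.exists_subgroup_v_eq_one (K := K)
  obtain ⟨H, hH⟩ := exists_subgroup_orderUnits (ρ := ρ) (α := α) hvρ (ϖE ^ j)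
  obtain ⟨Ut, hUt⟩ := exists_subgroup_thetaFixed_units (K := K) (Θ := Θ)
  have hvc : Valued.v (ϖE ^ j * (α - ρ α)) = exp (-(j : ℤ)) := by
    rw [map_mul, hα, mul_one, map_pow, hϖE, ← exp_nsmul, nsmul_eq_mul, mul_neg, mul_one]
  have hHU : H ≤ U := fun u hu => (hU u).2 ((hH u).1 hu).1
  have hHrel : H.relIndex U = if j = 0 then 1 else (q + 1) * q ^ (j - 1) := by
    split_ifs with hj0
    · subst hj0
      rw [Subgroup.relIndex_eq_one]
      intro u hu
      rw [hH]
      refine ⟨(hU u).1 hu, ?_⟩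
      rw [hvc]
      refine (Valuation.map_sub _ _ _).trans ?_
      rw [hvρ, (hU u).1 hu, max_self]; norm_num
    · have hH' : ∀ u, u ∈ H ↔ Valued.v (u : K) = 1 ∧ Valued.v ((u : K) - ρ u) ≤ Valued.v (ϖE ^ j) := fun u => by
        rw [hH u, map_mul Valued.v (ϖE ^ j), hα, mul_one]
      exact relIndex_orderUnits_eq_of_unramified hρρ hvρ hα1 hα hϖE hq (Nat.one_le_iff_ne_zero.2 hj0) U H hU hH'
  have hHU0 : H.relIndex U ≠ 0 := by
    rw [hHrel]; split_ifs
    · exact one_ne_zero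
    · exact mul_ne_zero (by omega) (pow_ne_zero _ hq0.ne')
  have hBk : ∀ c : ℕ, ∃ B : Subgroup Kˣ,
      (∀ ω, ω ∈ B ↔ Valued.v (ω : K) = 1 ∧ Valued.v ((ω : K) * Θ ω - ρ ((ω : K) * Θ ω)) ≤ exp (-(c : ℤ))) ∧
      (B.relIndex U = if c = 0 then 1 else if c + 2 ≤ 2 * d then (q + 1) * q ^ ((c + 1) / 2 - 1) else (q + 1) * q ^ ((c + 1) / 2 - 1) / 2) ∧
      (2 * d ≤ c + 1 → B.relIndex U * 2 = (q + 1) * q ^ ((c + 1) / 2 - 1)) ∧ B ≤ U ∧ (c ≤ j → H ≤ B) := fun c => by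
    obtain ⟨B, hB⟩ := exists_subgroup_normDepth (Θ := Θ) hvρ hvΘ (exp (-(c : ℤ)))
    obtain ⟨Vt, hVt⟩ := exists_subgroup_thetaFixed_depth (K := K) (Θ := Θ) hvρ (exp (-(c : ℤ)))
    refine ⟨B, hB, relIndex_normDepth_eq_of_ramK hρρ hvρ hα1 hα hΘρ hD hρϖ hσ' hvσ' hα'1 hα' hπ' hq' jK hjv hjΘ hjfix hjσ c U Ut Vt B hU hUt hVt hB,
      fun hc => relIndex_normDepth_mul_two_eq_of_ramK hρρ hvρ hα1 hα hΘρ hD hρϖ hσ' hvσ' hα'1 hα' hπ' hq' jK hjv hjΘ hjfix hjσ hc U Ut Vt B hU hUt hVt hB,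
      fun ω hω => (hU ω).2 ((hB ω).1 hω).1, fun hcj => ?_⟩
    exact orderUnits_le_normDepth hvρ hΘρ hvΘ (by rw [hvc, exp_le_exp]; omega) hH hB
  have hfinB : ∀ B : Subgroup Kˣ, H ≤ B → B ≤ U → ((QuotientGroup.mk : Kˣ → Kˣ ⧸ H) '' (ω₀ • (B : Set Kˣ))).Finite := fun B hHB hBU => by
    apply Set.finite_of_ncard_ne_zero
    rw [ncard_image_mk_smul_subgroup H B ω₀]
    have hmul := Subgroup.relIndex_mul_relIndex H B U hHB hBU
    exact left_ne_zero_of_mul (hmul.symm ▸ hHU0)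
  -- (3) the count
  rw [F0P3cDyRamToricLevelCensusUnr.levelSet_eq_setOf hϖE]
  by_cases hpar : (j + a) % 2 = 0
  swap
  · -- ODD PARITY (`v(h)` is even): empty
    rw [ncard_levelSet_eq_zero_of_odd hvρ hvΘ hα hϖE hvh j a (fun k' hk' => by omega) H hH]
    by_cases hj0 : j = 0
    · subst hj0; rw [if_pos rfl, if_neg (by omega)]
    · rw [if_neg hj0, if_pos (by omega : j < a ∨ (j - a) % 2 = 1)]
  by_cases ha0 : a = 0
  · -- LEVEL 0: `[B_j : H]`
    subst ha0
    obtain ⟨B, hB, hBU, hBU2, hBle, hHB⟩ := hBk j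
    rw [ncard_levelSet_zero_eq_relIndex hρρ hvρ hΘρ hvΘ hα hϖE hρϖ hh hvh j (k₀ := -k - ((j / 2 : ℕ) : ℤ))
      (by push_cast; omega) hω₀ hη H B hH hB]
    have hmul := Subgroup.relIndex_mul_relIndex H B U (hHB le_rfl) hBle
    rw [hHrel] at hmul
    by_cases hj0 : j = 0
    · subst hj0
      rw [if_pos rfl, if_pos rfl]
      rw [hBU, if_pos rfl, if_pos rfl, mul_one] at hmul
      exact hmul
    rw [if_neg hj0, if_neg (by omega), if_neg (fun h0 => hj0 h0.symm), if_pos rfl]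
    rw [if_neg hj0] at hmul
    have he : (j + 1) / 2 - 1 + j / 2 = j - 1 := by omega
    by_cases hdj : 2 * d ≤ j + 1
    · -- halved index: `[B_j:H]·(q+1)q^{(j+1)/2−1} = 2(q+1)q^{j−1}`
      rw [if_pos hdj]
      have h2 := hBU2 hdj
      have hmul2 : H.relIndex B * ((q + 1) * q ^ ((j + 1) / 2 - 1)) = 2 * ((q + 1) * q ^ (j - 1)) := by
        rw [← h2, ← mul_assoc, hmul]; ring
      refine Nat.eq_of_mul_eq_mul_right (show 0 < (q + 1) * q ^ ((j + 1) / 2 - 1) from mul_pos (by omega) (pow_pos hq0 _)) ?_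
      rw [hmul2, ← he, pow_add]; ring
    · rw [if_neg hdj, one_mul]
      rw [hBU, if_neg hj0, if_pos (by omega)] at hmul
      refine Nat.eq_of_mul_eq_mul_right (show 0 < (q + 1) * q ^ ((j + 1) / 2 - 1) from mul_pos (by omega) (pow_pos hq0 _)) ?_
      rw [hmul, ← he, pow_add]; ring
  have ha1 : 1 ≤ a := Nat.one_le_iff_ne_zero.2 ha0
  by_cases haj : a ≤ j
  · -- 1 ≤ a ≤ j, c = j − a even: `[B_c : H] − [B_{c+1} : H]`
    have hj0 : j ≠ 0 := by omega
    obtain ⟨B, hB, hBU, hBU2, hBle, hHB⟩ := hBk (j - a)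
    obtain ⟨B', hB', hB'U, hB'U2, hB'le, hHB'⟩ := hBk (j - a + 1)
    have e1 : (-((j - a : ℕ) : ℤ)) = -((j : ℤ) - a) := by omega
    have e2 : (-((j - a + 1 : ℕ) : ℤ)) = -((j : ℤ) - a + 1) := by omega
    have hBD : ∀ ω : Kˣ, ω ∈ B ↔ Valued.v (ω : K) = 1 ∧ Valued.v ((ω : K) * Θ ω - ρ ((ω : K) * Θ ω)) ≤ exp (-((j : ℤ) - a)) :=
      fun ω => by rw [hB ω, e1]
    have hB'D : ∀ ω : Kˣ, ω ∈ B' ↔ Valued.v (ω : K) = 1 ∧ Valued.v ((ω : K) * Θ ω - ρ ((ω : K) * Θ ω)) ≤ exp (-((j : ℤ) - a + 1)) :=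
      fun ω => by rw [hB' ω, e2]
    rw [ncard_levelSet_eq_relIndex_sub hρρ hvρ hΘρ hvΘ hα hϖE hρϖ hh hvh j ha1 (k₀ := -k + (((j + a) / 2 : ℕ) : ℤ) - j)
      (by push_cast; omega) hω₀ hη H B B' hH hBD hB'D (hHB' (by omega)) (hfinB B (hHB (by omega)) hBle)]
    have hmul := Subgroup.relIndex_mul_relIndex H B U (hHB (by omega)) hBle
    have hmul' := Subgroup.relIndex_mul_relIndex H B' U (hHB' (by omega)) hB'le
    rw [hHrel, if_neg hj0] at hmul hmul'
    rw [if_neg hj0, if_neg (by omega)]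
    by_cases hja : a = j
    · -- c = 0: `[B_0 : H] = |G_j|`, `[B_1 : H] = q^{j−1}` (d ≥ 2) or `2q^{j−1}` (d = 1)
      subst hja
      rw [if_pos rfl]
      rw [hBU, if_pos (Nat.sub_self a), mul_one] at hmul
      simp only [Nat.sub_self, zero_add, Nat.reduceAdd, Nat.reduceDiv, pow_zero, mul_one] at hB'U hB'U2
      have hpow : q ^ a = q * q ^ (a - 1) := by rw [← pow_succ']; congr 1; omega
      by_cases hd2 : 2 ≤ d
      · rw [if_pos hd2]
        rw [hB'U, if_neg one_ne_zero, if_pos (by omega)] at hmul'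
        have hX' : H.relIndex B' = q ^ (a - 1) := by
          refine Nat.eq_of_mul_eq_mul_right (show 0 < q + 1 by omega) ?_
          rw [hmul']; ring
        rw [hmul, hX', hpow]
        have hle : q ^ (a - 1) ≤ (q + 1) * q ^ (a - 1) := Nat.le_mul_of_pos_left _ (by omega)
        zify [hle]; ring
      · rw [if_neg hd2]
        have h2 := hB'U2 (by omega)
        have hmul2 : H.relIndex B' * (q + 1) = (q + 1) * q ^ (a - 1) * 2 := by
          rw [← hmul', mul_assoc, h2]
        have hX' : H.relIndex B' = 2 * q ^ (a - 1) := by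
          refine Nat.eq_of_mul_eq_mul_right (show 0 < q + 1 by omega) ?_
          rw [hmul2]; ring
        rw [hmul, hX']
        have hle : 2 * q ^ (a - 1) ≤ (q + 1) * q ^ (a - 1) := Nat.mul_le_mul_right _ (by omega)
        have hq1 : 1 ≤ q := hq0
        zify [hle, hq1]; ring
    -- 2 ≤ c = j − a even
    have hc2 : 2 ≤ j - a := by omega
    rw [if_neg hja, if_neg ha0]
    have he : (j - a + 1) / 2 - 1 = (j - a) / 2 - 1 := by omega
    have he' : (j - a + 1 + 1) / 2 - 1 = (j - a) / 2 := by omega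
    rw [he] at hBU hBU2
    rw [he'] at hB'U hB'U2
    have hcne : j - a ≠ 0 := by omega
    have hcne' : j - a + 1 ≠ 0 := by omega
    -- the outer index is always of the FULL kind or the HALVED kind; likewise the inner one
    have hpow1 : q ^ (j - 1) = q * q ^ (j - 1 - (j - a) / 2) * q ^ ((j - a) / 2 - 1) := by
      rw [← pow_succ', ← pow_add]; congr 1; omega
    have hpow2 : q ^ (j - 1) = q ^ (j - 1 - (j - a) / 2) * q ^ ((j - a) / 2) := by
      rw [← pow_add]; congr 1; omega
    have hXfull : j - a + 2 ≤ 2 * d → H.relIndex B = q * q ^ (j - 1 - (j - a) / 2) := fun hle => by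
      rw [hBU, if_neg hcne, if_pos hle] at hmul
      refine Nat.eq_of_mul_eq_mul_right (show 0 < (q + 1) * q ^ ((j - a) / 2 - 1) from mul_pos (by omega) (pow_pos hq0 _)) ?_
      rw [hmul, hpow1]; ring
    have hXhalf : 2 * d ≤ j - a + 1 → H.relIndex B = 2 * (q * q ^ (j - 1 - (j - a) / 2)) := fun hle => by
      have h2 := hBU2 hle
      have hmul2 : H.relIndex B * ((q + 1) * q ^ ((j - a) / 2 - 1)) = 2 * ((q + 1) * q ^ (j - 1)) := by
        rw [← h2, ← mul_assoc, hmul]; ring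
      refine Nat.eq_of_mul_eq_mul_right (show 0 < (q + 1) * q ^ ((j - a) / 2 - 1) from mul_pos (by omega) (pow_pos hq0 _)) ?_
      rw [hmul2, hpow1]; ring
    have hX'full : j - a + 1 + 2 ≤ 2 * d → H.relIndex B' = q ^ (j - 1 - (j - a) / 2) := fun hle => by
      rw [hB'U, if_neg hcne', if_pos hle] at hmul'
      refine Nat.eq_of_mul_eq_mul_right (show 0 < (q + 1) * q ^ ((j - a) / 2) from mul_pos (by omega) (pow_pos hq0 _)) ?_
      rw [hmul', hpow2]; ring
    have hX'half : 2 * d ≤ j - a + 1 + 1 → H.relIndex B' = 2 * q ^ (j - 1 - (j - a) / 2) := fun hle => by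
      have h2 := hB'U2 hle
      have hmul2 : H.relIndex B' * ((q + 1) * q ^ ((j - a) / 2)) = 2 * ((q + 1) * q ^ (j - 1)) := by
        rw [← h2, ← mul_assoc, hmul']; ring
      refine Nat.eq_of_mul_eq_mul_right (show 0 < (q + 1) * q ^ ((j - a) / 2) from mul_pos (by omega) (pow_pos hq0 _)) ?_
      rw [hmul2, hpow2]; ring
    by_cases hlt : j - a + 2 < 2 * d
    · rw [if_pos hlt, hXfull (by omega), hX'full (by omega), Nat.sub_mul, one_mul]
    rw [if_neg hlt]
    by_cases heq : j - a + 2 = 2 * d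
    · rw [if_pos heq, hXfull (by omega), hX'half (by omega)]
      have hjd : j - d = j - 1 - (j - a) / 2 := by omega
      rw [hjd, Nat.sub_mul]
    · rw [if_neg heq, hXhalf (by omega), hX'half (by omega)]
      have hle : 2 * q ^ (j - 1 - (j - a) / 2) ≤ 2 * (q * q ^ (j - 1 - (j - a) / 2)) :=
        Nat.mul_le_mul_left _ (Nat.le_mul_of_pos_left _ hq0)
      have hq1 : 1 ≤ q := hq0
      zify [hle, hq1]; ring
  · -- a > j: the two depth conditions are vacuous on units, `[U : H] − [U : H] = 0`
    have hvac : ∀ (t' : ℤ), 0 ≤ t' → ∀ ω : Kˣ, Valued.v (ω : K) = 1 →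
        Valued.v ((ω : K) * Θ ω - ρ ((ω : K) * Θ ω)) ≤ exp t' := fun t' ht ω hω => by
      have hvN' : Valued.v ((ω : K) * Θ ω) = 1 := by rw [map_mul, hvΘ, hω, mul_one]
      refine (Valuation.map_sub _ _ _).trans ?_
      rw [hvρ, hvN', max_self, ← exp_zero, exp_le_exp]; exact ht
    have hUD : ∀ ω : Kˣ, ω ∈ U ↔ Valued.v (ω : K) = 1 ∧ Valued.v ((ω : K) * Θ ω - ρ ((ω : K) * Θ ω)) ≤ exp (-((j : ℤ) - a)) :=
      fun ω => by rw [hU ω]; exact ⟨fun h1 => ⟨h1, hvac _ (by omega) ω h1⟩, fun h1 => h1.1⟩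
    have hUD' : ∀ ω : Kˣ, ω ∈ U ↔ Valued.v (ω : K) = 1 ∧ Valued.v ((ω : K) * Θ ω - ρ ((ω : K) * Θ ω)) ≤ exp (-((j : ℤ) - a + 1)) :=
      fun ω => by rw [hU ω]; exact ⟨fun h1 => ⟨h1, hvac _ (by omega) ω h1⟩, fun h1 => h1.1⟩
    rw [ncard_levelSet_eq_relIndex_sub hρρ hvρ hΘρ hvΘ hα hϖE hρϖ hh hvh j ha1 (k₀ := -k + (((a + j) / 2 : ℕ) : ℤ) - j)
      (by push_cast; omega) hω₀ hη H U U hH hUD hUD' hHU (hfinB U hHU le_rfl), Nat.sub_self]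
    by_cases hj0 : j = 0
    · subst hj0; rw [if_pos rfl, if_neg ha0]
    · rw [if_neg hj0, if_pos (Or.inl (by omega))]

end Summit.HodgeConjecture.HodgeConjecture.Cruxes.H413.F0P3cDyRamToricLevelCensusRamK
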